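import Literature.MathematicalPhysics.QuantumFieldTheory.BalabanImbrieJaffe1984to88.BIJ88BgInvariance416Torus

/-!
# `BalabanImbrieJaffe1984to88.BIJ88Eq596BgTorus` — T. Bałaban, J. Imbrie, A. Jaffe, *Effective action and cluster properties of the abelian
Higgs model*, Commun. Math. Phys. **114** (1988) 257–315 [BalabanImbrieJaffe1988], (5.9.6) p. 297 [PDF 41] with (4.16) p. 276 [PDF 20],
(5.4.5) p. 282 [PDF 26] and p. 283 [PDF 27]: **(5.9.6) AT MEASURE LEVEL — THE C2.Eq5.9.6 HEAD `BIJ88Eq596BySteps.eq596_bySteps` (AND ITS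
v1.1 `eq596_bySteps_ins`) WITH THE (4.16)-CLAUSES `hQcov`, `hΔ`, `hZaway` DISCHARGED FOR THE CONCRETE TORUS SLOTS** — the covariant average
`Q(ū_k(u_k))φ` of (5.1.4), p31's localized scalar form `Δ_{k,loc}(u_k)` of (2.34), and the (4.9) Gaussian normalization factors
`Z^{(j)}_{Λ₁₀^{(j)}}(u_k)` — by the companion `BIJ88BgInvariance416Torus` ((4.16) PROVED for these factors).

statement-level skeleton of published theorems with citation tags; proofs where landed; nothing here is a claim about the Yang–Mills mass gap

PDF held: `paper:balaban1988-cmp114-bij-abelian-higgs-effective-action` (journal page = PDF page + 256); pp. 274–278 [PDF 18–22] read as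
images for the companion this session; (5.4.5) p. 282, p. 283 and (5.9.6) p. 297 as quoted verbatim in gen 13's `BIJ88Eq596BySteps` (pages
re-read as images there).

CITATION HEADER (lean-in-tree rule).  Part of the lit-balaban TYPED SKELETON (HOME `run/shared/lean/pub/lit-balaban/`), PHASE-2 proof seat
p34 gen 15 (unit `lit-balaban-p34-g15`; TAKING line HOME/STATUS.md 2026-08-22T20:45:50Z, free-target protocol G.5-34(d); own lineage).  Row
served: **C2.Eq5.9.6** of `HOME/lit-balaban-r16/ROWS-C2-part2.md` (owner r16; flipped typed → proved-with-clauses K1–K6 at v2.166 on gen 13's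
`eq596_bySteps`; K1 = the (4.16)-clauses) — MEMBER: K1 discharged for the concrete slots; no head claim.

THE PRINTED TEXT (verbatim).  p. 276 [PDF 20]: *"Finally, we assume that every factor or term in our starting expression is gauge invariant
in the following senses. Gauge transformations u_{k,b} → u_{k,b}e^{−ie_kη(∂^ηλ)(b)}, φ(x) → φ(x)e^{ie_kλ(x)} (4.16) leave each expression
invariant."*  p. 277 [PDF 21]: *"Note that λ above is any real function on T_η, although only its values on T₁^{(k)} are relevant for φ."*
p. 282 [PDF 26]: *"The background gauge transformation u_{k,b} → u′_{k,b} = u_{k,b} exp(−ie_kη(∂Λ̄₃^{(k)}C_k□A′)(b)), φ(x) → φ(x) exp(ie_k(Λ̄₃^{(k)}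
C_k□A′)(x)), ψ(y) → ψ(y) exp(ie_k(Λ̄₃^{(k)}C_k□A′)(y)), (5.4.5) is now performed on the term localized in □₀."*  p. 283 [PDF 27]: *"We can
gauge away the term ∂C_kΛ₃^{(k)*}A′, leaving us with the following background gauge field for the normalization factors: … (5.4.10)"*.

THE READING.  Everything as in `BIJ88Eq596BySteps` (terms `T t : Term41 P k` of (4.1), the (5.2.8) frame, the table `fillSteps`, the
readings), with THREE SLOTS MADE CONCRETE through slot identities: (i) the background `u_k` of the term is a `U(1)` configuration on `T_η`
read in `ℂ` (`hukT : (T t).uk prev u = cfg (ukU t prev u)`); (ii) the `Δ_{k,loc}(u_k)`-slot IS p31's `BIJ88DeltaLoc234Torus.deltaLocT` at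
depth `k` (`hΔT`; cube family of `k`-block unions, weights, cut-off — DATA, as in p31's files); (iii) the `Z^{(j)}_{Λ₁₀^{(j)}}(u_k)`-slots ARE
the (4.9) integrals `BIJ88BgInvariance416Torus.z49Slot` at depth `j` (`hZT`); and the rotation data (5.4.5) is `rotTorus`: the `Q(u_k)`-slot
is `Q(ū_k(u_k))φ` (companion's corner-convention (4.4) `barUc`, r18's (2.6) `qCov`), `λ_k = λ∘cornerIter k∘e`, `λ_L = λ∘cornerIter (k+1)∘e′`
for the gauge function `λ` on `T_η` and the identifications `e : Site P k ≃ Site P (0+k)`, `e′ : Site P (k+1) ≃ Site P (0+k+1)` of the term's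
lattices with the depth-`k`/`k+1` tori over `T_η` (the level casts `T^{(k)} = T^{(0+k)}` in the intended reading; the clauses hold for any
identification, the geometry sits in `cornerIter ∘ e`).

WHAT IS PROVED (kernel-checked; 0 `sorry`; definitions with bodies `rotTorus`, `siteCast` + theorems; NO `Prop`-valued fact; standard axioms).
* §1 `rotTorus` (the `RotationReading` with the concrete `Q`-slot), `siteCast` (the level identification `n = n′` as an
  equivalence; `siteCast (Nat.zero_add k).symm` is the intended `e`), `bgGaugePhi_comp_equiv`.
* §2 the three clauses as theorems: **`hQcov_torus`**, **`hΔ_torus`**, **`hZaway_torus`** (exactly the hypotheses `hQcov`, `hΔ`, `hZaway` of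
  `eq596_bySteps` for `R := rotTorus`, from the companion's `qCov_barUc_bg`, `deltaLocT_bg_apply` (through gen 13's `scalarForm_bg_of_kernel`),
  `z49Slot_bg`).
* §3 **`eq596_bySteps_bgTorus`** = `eq596_bySteps` with `hQcov`/`hΔ`/`hZaway` DISCHARGED (remaining displayed: standing data of (5.2.8)/(5.9.6),
  `Laws`/regularity, the readings `hread`/`hQread`/`hPread`/`hreadS`/`hZread`/`hZv`, the clause `hPinv` for the `𝒫_{k,loc}`-slot — no body
  in the tree, p. 275 *"a later paper"* — and (C) `hins`); **`eq596_bySteps_ins_bgTorus`** = the same for the v1.1 head with (C) discharged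
  from the five printed bounds (5.9.1)–(5.9.5) (`BIJ88Eq596Insertions.hins_of_bounds`).
HONEST SCOPE.  The slots are made concrete BY HYPOTHESIS (slot identities on the abstract `Term41`), not by constructing a term; the
readings stay displayed; `𝒫_{k,loc}`'s (4.16) stays a clause.  Imports the companion `BIJ88BgInvariance416Torus` only (→ gen 13's
`BIJ88Eq596BySteps`, p31's `BIJ88Eq240FlatTorus`; Literature + Mathlib).  Seat p34 gen 15, 2026-08-22.  NOT summit progress.
-/

namespace Literature.MathematicalPhysics.QuantumFieldTheory.BalabanImbrieJaffe1984to88.BIJ88Eq596BgTorus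

open Literature.MathematicalPhysics.QuantumFieldTheory.Balaban1983to89
open BIJ88Sect3Statements (U1 toC cfg covD starB starP)
open BIJ85Sect1Model (HiggsField)
open BIJ88Sect4Statements (bgGaugeU bgGaugePhi)
open BIJ88RenormTransf311 (axialMeasure axialBonds gaussWeight DeltaAx)
open BIJ88InductiveForm41 (Prev Term41 gaugeForm scalarForm)
open BIJ85BlockAveragesTorus (qU qCov)
open BIJ85BlockAveragesTorusK (cornerIter)
open BIJ88RT52Restrictions (Fields fieldsMeasure IsRD)
open BIJ88Eq596Display (uCut IsDT)
open BIJ88RT552Transl (bondMul)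
open BIJ88Eq596Frame (Entry Bracket596 bracket596)
open BIJ88Eq596Density (rho596 renamedBracket)
open BIJ88Eq596Sectors (uOrig phiOrig psiOrig rho528 gaussQuad fill41)
open BIJ88Eq596SlotsByName (GaugeReading ScalarReading ZReading gLHS sMid2)
open BIJ88PertQ5715 (Zloc)
open BIJ88Eq596BySteps (RotationReading ukRot phiRot sMid1 fillSteps eq596_bySteps eq596_bySteps_ins scalarForm_bg_of_kernel)
open BIJ88Eq596Insertions (InsertionReading chiIns hins_of_bounds)
open BIJ88NeumannNoZeroModesTorus (IsBlockUnion)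
open BIJ88DeltaLoc234Torus (deltaLocT)
open BIJ88BgInvariance416Torus (toU1Field toU1Field_cfg barUc qCov_barUc_bg deltaLocT_bg_apply z49Slot z49Slot_bg)
open scoped BigOperators
open _root_.MeasureTheory Complex

noncomputable section

variable {P : Params} {k : ℕ}

/-! ## §1 The rotation data (5.4.5) with the CONCRETE `Q(ū_k)`-slot -/

section Reading

variable {ι : Type*}

variable (P k ι) in
/-- **The (5.4.5) rotation data of `BIJ88Eq596BySteps` with the CONCRETE `Q(u_k)`-slot `Q(ū_k(u_k))φ` of (5.1.4)** (corner-convention (4.4)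
`BIJ88BgInvariance416Torus.barUc`, r18's (2.6) `qCov`; the background read through `toU1Field`): from `e_k`, `η`, the gauge function
`λ = Λ̄₃^{(k)}C_k□A′` on `T_η` read per term on the configuration (`lam0`), the `𝒫_{k,loc}`-slot `PB` (no body in the tree: p. 275 *"a later
paper"*), and the identifications `e`, `e′` of the unit and block lattices of the term with the tori of depth `k`, `k+1` over `T_η` (the level
casts `T^{(k)} = T^{(0+k)}` in the intended reading): `λ_k = λ∘cornerIter k∘e`, `λ_L = λ∘cornerIter (k+1)∘e′` (p. 277: *"λ above is any real
function on T_η, although only its values on T₁^{(k)} are relevant for φ"*). [cite: BalabanImbrieJaffe1988, (5.4.5) p.282] -/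
def rotTorus (ek η : ℝ) (lam0 : ι → Prev P k → GaugeField P k U1 → GaugeField P (k+1) U1 → Balaban1983to89.Site P 0 → ℝ)
    (PB : ι → Prev P k → (PBond P 0 → ℂ) → HiggsField P k → ℝ)
    (e : Balaban1983to89.Site P k ≃ Balaban1983to89.Site P (0 + k)) (e' : Balaban1983to89.Site P (k+1) ≃ Balaban1983to89.Site P (0 + k + 1)) :
    RotationReading P k ι where
  ek := ek
  η := η
  lam0 := lam0
  lamk := fun t prev u' v x => lam0 t prev u' v (cornerIter k (e x))
  lamL := fun t prev u' v y => lam0 t prev u' v (cornerIter (k+1) (e' y))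
  QB := fun _ _ ukf φ y => qCov (barUc k (toU1Field ukf)) (fun z => φ (e.symm z)) (e' y)
  PB := PB

/-- The level identification `T^{(n)} = T^{(n′)}` for `n = n′` as an equivalence of site types — the cast `Site P k ≃ Site P (0+k)`
(`siteCast (Nat.zero_add k).symm`) feeding `e`, `e′` of `rotTorus` in the intended reading (p33/p11's `lvl`/`lvlR` transport bond
functions the same way). [cite: BalabanImbrieJaffe1988, (4.4) p.274] -/
def siteCast {n n' : ℕ} (h : n = n') : Balaban1983to89.Site P n ≃ Balaban1983to89.Site P n' := Equiv.cast (congrArg (Balaban1983to89.Site P) h)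

/-- kernel: the identification along `rfl` is the identity. [cite: BalabanImbrieJaffe1988, (4.4) p.274] -/
theorem siteCast_rfl {n : ℕ} (x : Balaban1983to89.Site P n) : siteCast (P := P) rfl x = x := rfl

/-- kernel: the rotated field read on the depth-`k` torus is the field read there, rotated by `λ∘cornerIter k`.
[cite: BalabanImbrieJaffe1988, (5.4.5) p.282] -/
theorem bgGaugePhi_comp_equiv (ek : ℝ) (lam0 : Balaban1983to89.Site P 0 → ℝ) (e : Balaban1983to89.Site P k ≃ Balaban1983to89.Site P (0 + k))
    (φ : HiggsField P k) :
    (fun z => bgGaugePhi ek (fun x : Balaban1983to89.Site P k => lam0 (cornerIter k (e x))) φ (e.symm z)) =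
      bgGaugePhi ek (fun x : Balaban1983to89.Site P (0+k) => lam0 (cornerIter k x)) (fun z => φ (e.symm z)) := by
  funext z
  simp only [bgGaugePhi, Equiv.apply_symm_apply]

end Reading

/-! ## §2 The three (4.16)-clauses of `eq596_bySteps` DISCHARGED for the concrete slots -/

section Clauses

variable {ι : Type*} {terms : Finset ι}

/-- **CLAUSE `hQcov` DISCHARGED** for the `Q(ū_k)`-slot of `rotTorus`: at every term and configuration, the rotated background and field give
the rotated average — `BIJ88BgInvariance416Torus.qCov_barUc_bg` read through the slot identity `hukT` (the background is a `U(1)`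
configuration) and the level identifications. [cite: BalabanImbrieJaffe1988, (5.1.4) p.278] -/
theorem hQcov_torus (T : ι → Term41 P k) (Λ : ι → Finset (PBond P (k+1))) (s : ι → GaugeField P (k+1) U1 → GaugeField P k U1)
    (lamφ : ι → Prev P k → GaugeField P k U1 → GaugeField P (k+1) U1 → GaugeTransf P k U1)
    (c : ι → Prev P k → GaugeField P k U1 → GaugeField P (k+1) U1 → HiggsField P (k+1) → HiggsField P k)
    (hk : k + 1 ≤ P.m + P.K)
    (ukU : ι → Prev P k → (PBond P k → ℂ) → GaugeField P 0 U1) (hukT : ∀ t prev u, (T t).uk prev u = cfg (ukU t prev u))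
    (e : Balaban1983to89.Site P k ≃ Balaban1983to89.Site P (0 + k)) (e' : Balaban1983to89.Site P (k+1) ≃ Balaban1983to89.Site P (0 + k + 1))
    {ek η : ℝ} (hη : η ≠ 0) (lam0 : ι → Prev P k → GaugeField P k U1 → GaugeField P (k+1) U1 → Balaban1983to89.Site P 0 → ℝ)
    (PB : ι → Prev P k → (PBond P 0 → ℂ) → HiggsField P k → ℝ) :
    ∀ t ∈ terms, ∀ prev u' v φ ψ, DeltaAx u' →
      (rotTorus P k ι ek η lam0 PB e e').QB t prev (ukRot (rotTorus P k ι ek η lam0 PB e e') T Λ s t prev u' v)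
          (phiRot (rotTorus P k ι ek η lam0 PB e e') Λ s lamφ c t prev u' v φ ψ) =
        bgGaugePhi (rotTorus P k ι ek η lam0 PB e e').ek ((rotTorus P k ι ek η lam0 PB e e').lamL t prev u' v)
          ((rotTorus P k ι ek η lam0 PB e e').QB t prev ((T t).uk prev (cfg (uOrig Λ s t u' v)))
            (phiOrig Λ s lamφ c t prev u' v φ ψ)) := by
  intro t _ prev u' v φ ψ _
  funext y
  simp only [rotTorus, ukRot, phiRot, hukT]
  rw [bgGaugePhi_comp_equiv, qCov_barUc_bg (by omega) hη]
  simp only [bgGaugePhi]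

/-- **CLAUSE `hΔ` DISCHARGED** for a `Δ_{k,loc}`-slot that IS p31's `deltaLocT` (slot identity `hΔT`; cube family of `k`-block unions, `a > 0`,
`c ≠ 0`): `⟨Λ₈′φ′, Δ_{k,loc}(u′_k)Λ₈′φ′⟩ = ⟨Λ₈′φ, Δ_{k,loc}(u_k)Λ₈′φ⟩` — gen 13's `scalarForm_bg_of_kernel` fed by
`BIJ88BgInvariance416Torus.deltaLocT_bg_apply`. [cite: BalabanImbrieJaffe1988, (4.16) p.276] -/
theorem hΔ_torus (T : ι → Term41 P k) (Λ : ι → Finset (PBond P (k+1))) (s : ι → GaugeField P (k+1) U1 → GaugeField P k U1)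
    (lamφ : ι → Prev P k → GaugeField P k U1 → GaugeField P (k+1) U1 → GaugeTransf P k U1)
    (c : ι → Prev P k → GaugeField P k U1 → GaugeField P (k+1) U1 → HiggsField P (k+1) → HiggsField P k)
    (hk : k + 1 ≤ P.m + P.K)
    (ukU : ι → Prev P k → (PBond P k → ℂ) → GaugeField P 0 U1) (hukT : ∀ t prev u, (T t).uk prev u = cfg (ukU t prev u))
    (e : Balaban1983to89.Site P k ≃ Balaban1983to89.Site P (0 + k)) (e' : Balaban1983to89.Site P (k+1) ≃ Balaban1983to89.Site P (0 + k + 1))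
    {ek η : ℝ} (hη : η ≠ 0) (lam0 : ι → Prev P k → GaugeField P k U1 → GaugeField P (k+1) U1 → Balaban1983to89.Site P 0 → ℝ)
    (PB : ι → Prev P k → (PBond P 0 → ℂ) → HiggsField P k → ℝ)
    {ιD : ι → Type} [∀ t, Fintype (ιD t)] {aD cD : ι → ℝ} (haD : ∀ t, 0 < aD t) (hcD : ∀ t, cD t ≠ 0)
    {cubeD : (t : ι) → ιD t → Finset (Balaban1983to89.Site P 0)} (hcubeD : ∀ t α, IsBlockUnion k (cubeD t α))
    (lamD : (t : ι) → ιD t → Balaban1983to89.Site P 0 → Balaban1983to89.Site P 0 → ℝ)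
    (ζD : ι → Balaban1983to89.Site P 0 → Balaban1983to89.Site P 0 → ℝ)
    (hΔT : ∀ t ukf y₁ y₂, (T t).Δloc ukf y₁ y₂ = deltaLocT (aD t) (cD t) (toU1Field ukf) k (cubeD t) (lamD t) (ζD t) (e y₁) (e y₂)) :
    ∀ t ∈ terms, ∀ prev u' v φ ψ, DeltaAx u' →
      scalarForm (T t) (ukRot (rotTorus P k ι ek η lam0 PB e e') T Λ s t prev u' v)
          (phiRot (rotTorus P k ι ek η lam0 PB e e') Λ s lamφ c t prev u' v φ ψ) =
        scalarForm (T t) ((T t).uk prev (cfg (uOrig Λ s t u' v))) (phiOrig Λ s lamφ c t prev u' v φ ψ) := by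
  intro t _ prev u' v φ ψ _
  simp only [rotTorus, ukRot, phiRot, hukT]
  exact scalarForm_bg_of_kernel (T t) ek η (lam0 t prev u' v) (fun x => lam0 t prev u' v (cornerIter k (e x)))
    (cfg (ukU t prev (cfg (uOrig Λ s t u' v)))) _ fun y₁ _ y₂ _ => by
      rw [hΔT, hΔT, deltaLocT_bg_apply (by omega) (hcD t) (haD t) hη (hcubeD t)]

/-- **CLAUSE `hZaway` DISCHARGED** for `Z^{(j)}_{Λ₁₀^{(j)}}(u_k)`-slots that ARE the (4.9) Gaussian integrals `z49Slot` at depth `j`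
(slot identity `hZT`; cube families of `j`-block unions, `a > 0`, `c ≠ 0`, any `κ`, `Λ₁₀^{(j)}`, `E`, `N`): the factors are unchanged when
the background is gauged away by `λ_Z` — `BIJ88BgInvariance416Torus.z49Slot_bg`. [cite: BalabanImbrieJaffe1988, (5.4.10) p.283] -/
theorem hZaway_torus (T : ι → Term41 P k) (Λ : ι → Finset (PBond P (k+1))) (s : ι → GaugeField P (k+1) U1 → GaugeField P k U1)
    (hk : k + 1 ≤ P.m + P.K)
    (ukU : ι → Prev P k → (PBond P k → ℂ) → GaugeField P 0 U1) (hukT : ∀ t prev u, (T t).uk prev u = cfg (ukU t prev u))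
    {ιZ : ι → Fin k → Type} [∀ t j, Fintype (ιZ t j)] {aZ cZ : ι → Fin k → ℝ} (κZ EZ NZ : ι → Fin k → ℝ)
    (haZ : ∀ t j, 0 < aZ t j) (hcZ : ∀ t j, cZ t j ≠ 0)
    {cubeZ : (t : ι) → (j : Fin k) → ιZ t j → Finset (Balaban1983to89.Site P 0)} (hcubeZ : ∀ t j α, IsBlockUnion j.val (cubeZ t j α))
    (lamZw : (t : ι) → (j : Fin k) → ιZ t j → Balaban1983to89.Site P 0 → Balaban1983to89.Site P 0 → ℝ)
    (ζZ : ι → Fin k → Balaban1983to89.Site P 0 → Balaban1983to89.Site P 0 → ℝ)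
    (ΛZ : (t : ι) → (j : Fin k) → Finset (Balaban1983to89.Site P (0 + j.val)))
    (hZT : ∀ t j ukf, (T t).Zs j ukf = z49Slot (aZ t j) (cZ t j) j.val (cubeZ t j) (lamZw t j) (ζZ t j) (κZ t j) (ΛZ t j) (EZ t j) (NZ t j) ukf)
    {ekZ ηZ : ℝ} (hηZ : ηZ ≠ 0) (lamZ : ι → Prev P k → GaugeField P k U1 → GaugeField P (k+1) U1 → Balaban1983to89.Site P 0 → ℝ) :
    ∀ t ∈ terms, ∀ prev u' v, DeltaAx u' → ∀ j,
      (T t).Zs j ((T t).uk prev (cfg (uOrig Λ s t u' v))) =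
        (T t).Zs j (bgGaugeU ekZ ηZ (lamZ t prev u' v) ((T t).uk prev (cfg (uOrig Λ s t u' v)))) := by
  intro t _ prev u' v _ j
  rw [hZT, hZT, hukT]
  exact z49Slot_bg (by have := j.isLt; omega) (hcZ t j) (haZ t j) (hcubeZ t j) _ _ _ _ _ _ hηZ _ _

end Clauses

/-! ## §3 (5.9.6) at measure level with the (4.16)-clauses DISCHARGED for the concrete slots -/

section Assembly

variable {ι : Type*} {terms : Finset ι} {ρL : GaugeField P (k+1) U1 → HiggsField P (k+1) → ℂ}
variable {M : Type*} [NormedAddCommGroup M] [InnerProductSpace ℝ M]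
variable {M' N' F' : Type*} [NormedAddCommGroup M'] [InnerProductSpace ℝ M'] [NormedAddCommGroup N'] [InnerProductSpace ℝ N']
  [AddCommGroup F'] [Module ℝ F']
variable {nZ : Fin k → Type} [∀ j, Fintype (nZ j)] [∀ j, DecidableEq (nZ j)]

/-- **(5.9.6) AT MEASURE LEVEL — `BIJ88Eq596BySteps.eq596_bySteps` WITH ITS (4.16)-CLAUSES `hQcov`, `hΔ`, `hZaway` DISCHARGED FOR THE CONCRETE
TORUS SLOTS** (p. 276: *"we assume that every factor or term in our starting expression is gauge invariant"* — PROVED, not assumed, for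
these slots by `BIJ88BgInvariance416Torus`).  The terms `T t` are read through SLOT IDENTITIES: the background `u_k` is a `U(1)`
configuration on `T_η` (`hukT`: `(T t).uk prev u = cfg (ukU t prev u)`); the `Δ_{k,loc}(u_k)`-slot IS p31's `deltaLocT` of (2.34) at depth `k`
(`hΔT`, any cube family of `k`-block unions / weights / cut-off, `a > 0`, `c ≠ 0`, sites identified by `e`); the `Z^{(j)}_{Λ₁₀^{(j)}}(u_k)`-slots
ARE the (4.9) Gaussian integrals `z49Slot` at depth `j` (`hZT`: r18's `Z49` of p31's realified compressed precision `Δ_{j,loc}(u_k) + κP(ū_j)`);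
the `Q(u_k)`-slot is `Q(ū_k(u_k))φ` (`rotTorus`).  REMAINING HYPOTHESES = those of `eq596_bySteps` minus `hQcov`/`hΔ`/`hZaway`: the standing
data of (5.2.8)/(5.9.6), `Laws`/regularity, the READINGS `hread`, `hQread`, `hPread`, `hreadS`, `hZread`, `hZv`, the (4.16)-clause `hPinv`
for the `𝒫_{k,loc}`-slot (no body in the tree), and (C) `hins`.  Conclusion verbatim that of `eq596_bySteps` with `R := rotTorus`.
[cite: BalabanImbrieJaffe1988, (5.9.6) p.297] -/
theorem eq596_bySteps_bgTorus (D : Bracket596 P k ι) (T : ι → Term41 P k) (a : ℝ)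
    (Qφ : ι → Prev P k → GaugeField P k U1 → HiggsField P k → HiggsField P (k+1))
    (Λ : ι → Finset (PBond P (k+1))) (s : ι → GaugeField P (k+1) U1 → GaugeField P k U1)
    (lamφ : ι → Prev P k → GaugeField P k U1 → GaugeField P (k+1) U1 → GaugeTransf P k U1)
    (lamψ : ι → Prev P k → GaugeField P k U1 → GaugeField P (k+1) U1 → GaugeTransf P (k+1) U1)
    (c : ι → Prev P k → GaugeField P k U1 → GaugeField P (k+1) U1 → HiggsField P (k+1) → HiggsField P k)
    (RG : GaugeReading P k ι M) (RS : ScalarReading P k ι M' N' F') (RZ : ZReading P k ι nZ)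
    (w : ι → Prev P k → GaugeField P k U1 → HiggsField P k → HiggsField P (k+1) → ℝ)
    (hk : k + 1 ≤ P.m + P.K) (h528 : IsRD (axialMeasure P k U1) terms qU Qφ a (rho528 w T) ρL)
    (hρi : ∀ t ∈ terms, Integrable
      (fun q : Fields P k => rho528 w T t q.2.1 q.1 q.2.2.1 q.2.2.2 * (gaussWeight a (Qφ t q.2.1 q.1 q.2.2.1) q.2.2.2 : ℂ))
      (fieldsMeasure (axialMeasure P k U1)))
    (hmφ : ∀ t ∈ terms, Measurable fun x : GaugeField P k U1 × Prev P k => lamφ t x.2 (uCut qU (Λ t) x.1) (qU x.1))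
    (hmψ : ∀ t ∈ terms, Measurable fun x : GaugeField P k U1 × Prev P k => lamψ t x.2 (uCut qU (Λ t) x.1) (qU x.1))
    (hs : ∀ t ∈ terms, ∀ w, ∀ b ∈ (axialBonds : Finset (PBond P k)), s t w b = 1)
    (S : ι → Set (GaugeField P k U1))
    (hsupp : ∀ t ∈ terms, ∀ prev u' v φ ψ, renamedBracket Qφ a (rho528 w T) Λ lamφ lamψ t prev u' v φ ψ ≠ 0 → u' ∈ S t)
    (hQS : ∀ t ∈ terms, ∀ u' ∈ S t, ∀ w, qU (bondMul u' (s t w)) = qU u' ∧ qU (bondMul u' fun b => (s t w b)⁻¹) = qU u')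
    (χins : Entry P k ι ℝ)
    (hins : ∀ t ∈ terms, ∀ prev u' v φ ψ, DeltaAx u' →
      w t prev (uOrig Λ s t u' v) (phiOrig Λ s lamφ c t prev u' v φ ψ) (psiOrig Λ s lamψ t prev u' v ψ) *
        (T t).chi prev (cfg (uOrig Λ s t u' v)) (phiOrig Λ s lamφ c t prev u' v φ ψ) ≠ 0 → χins t prev u' v φ ψ = 1)
    -- (G): p02's §5.5 dictionary `Laws` and the reading (5.3.2)
    (hLG : ∀ t ∈ terms, (RG.O t).Laws)
    (hread : ∀ t ∈ terms, ∀ prev u' v, DeltaAx u' → (1 / 2 : ℝ) * gaugeForm (T t) (cfg (uOrig Λ s t u' v)) = gLHS RG t prev u' v)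
    -- THE CONCRETE SLOTS: background as a U(1) configuration, level identifications, rotation data, Δ_{k,loc} and Z^{(j)} slot identities
    (ukU : ι → Prev P k → (PBond P k → ℂ) → GaugeField P 0 U1) (hukT : ∀ t prev u, (T t).uk prev u = cfg (ukU t prev u))
    (e : Balaban1983to89.Site P k ≃ Balaban1983to89.Site P (0 + k)) (e' : Balaban1983to89.Site P (k+1) ≃ Balaban1983to89.Site P (0 + k + 1))
    (ek η : ℝ) (hη : η ≠ 0) (lam0 : ι → Prev P k → GaugeField P k U1 → GaugeField P (k+1) U1 → Balaban1983to89.Site P 0 → ℝ)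
    (PB : ι → Prev P k → (PBond P 0 → ℂ) → HiggsField P k → ℝ)
    {ιD : ι → Type} [∀ t, Fintype (ιD t)] (aD cD : ι → ℝ) (haD : ∀ t, 0 < aD t) (hcD : ∀ t, cD t ≠ 0)
    (cubeD : (t : ι) → ιD t → Finset (Balaban1983to89.Site P 0)) (hcubeD : ∀ t α, IsBlockUnion k (cubeD t α))
    (lamD : (t : ι) → ιD t → Balaban1983to89.Site P 0 → Balaban1983to89.Site P 0 → ℝ)
    (ζD : ι → Balaban1983to89.Site P 0 → Balaban1983to89.Site P 0 → ℝ)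
    (hΔT : ∀ t ukf y₁ y₂, (T t).Δloc ukf y₁ y₂ = deltaLocT (aD t) (cD t) (toU1Field ukf) k (cubeD t) (lamD t) (ζD t) (e y₁) (e y₂))
    {ιZ : ι → Fin k → Type} [∀ t j, Fintype (ιZ t j)] (aZ cZ κZ EZ NZ : ι → Fin k → ℝ) (haZ : ∀ t j, 0 < aZ t j) (hcZ : ∀ t j, cZ t j ≠ 0)
    (cubeZ : (t : ι) → (j : Fin k) → ιZ t j → Finset (Balaban1983to89.Site P 0)) (hcubeZ : ∀ t j α, IsBlockUnion j.val (cubeZ t j α))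
    (lamZw : (t : ι) → (j : Fin k) → ιZ t j → Balaban1983to89.Site P 0 → Balaban1983to89.Site P 0 → ℝ)
    (ζZ : ι → Fin k → Balaban1983to89.Site P 0 → Balaban1983to89.Site P 0 → ℝ)
    (ΛZ : (t : ι) → (j : Fin k) → Finset (Balaban1983to89.Site P (0 + j.val)))
    (hZT : ∀ t j ukf, (T t).Zs j ukf = z49Slot (aZ t j) (cZ t j) j.val (cubeZ t j) (lamZw t j) (ζZ t j) (κZ t j) (ΛZ t j) (EZ t j) (NZ t j) ukf)
    -- (S): the readings of the rotation step and the 𝒫_{k,loc} clause; the Sect. 5.6 family; p02's §5.8 dictionary `Laws`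
    (hQread : ∀ t ∈ terms, ∀ prev u' v φ ψ, DeltaAx u' →
      Qφ t prev (uOrig Λ s t u' v) (phiOrig Λ s lamφ c t prev u' v φ ψ) =
        (rotTorus P k ι ek η lam0 PB e e').QB t prev ((T t).uk prev (cfg (uOrig Λ s t u' v))) (phiOrig Λ s lamφ c t prev u' v φ ψ))
    (hPread : ∀ t ∈ terms, ∀ prev u' v φ ψ, DeltaAx u' →
      (T t).Ploc prev (cfg (uOrig Λ s t u' v)) (phiOrig Λ s lamφ c t prev u' v φ ψ) =
        PB t prev ((T t).uk prev (cfg (uOrig Λ s t u' v))) (phiOrig Λ s lamφ c t prev u' v φ ψ))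
    (hPinv : ∀ t ∈ terms, ∀ prev u' v φ ψ, DeltaAx u' →
      PB t prev (ukRot (rotTorus P k ι ek η lam0 PB e e') T Λ s t prev u' v)
          (phiRot (rotTorus P k ι ek η lam0 PB e e') Λ s lamφ c t prev u' v φ ψ) =
        PB t prev ((T t).uk prev (cfg (uOrig Λ s t u' v))) (phiOrig Λ s lamφ c t prev u' v φ ψ))
    (F : ι → Prev P k → GaugeField P k U1 → GaugeField P (k+1) U1 → HiggsField P k → HiggsField P (k+1) → ℝ → ℝ) (nbar : ℕ)
    (δR : Entry P k ι ℝ) (hLS : ∀ t ∈ terms, ∀ prev u' v, (RS.O t prev u' v).Laws)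
    (hreadS : ∀ t ∈ terms, ∀ prev u' v φ ψ, DeltaAx u' →
      F t prev u' v φ ψ 0 = sMid2 RS t prev u' v φ ψ + D.Pkloc t prev u' v φ ψ)
    -- (Z): the gauge-away function and the reading at the gauged background; p13's regularity
    (ekZ ηZ : ℝ) (hηZ : ηZ ≠ 0) (lamZ : ι → Prev P k → GaugeField P k U1 → GaugeField P (k+1) U1 → Balaban1983to89.Site P 0 → ℝ)
    (hZv : ∀ t ∈ terms, ∀ j, (T t).Zv j = RZ.Zv t j)
    (hZread : ∀ t ∈ terms, ∀ prev u' v, DeltaAx u' → ∀ j,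
      (T t).Zs j (bgGaugeU ekZ ηZ (lamZ t prev u' v) ((T t).uk prev (cfg (uOrig Λ s t u' v)))) = Zloc (RZ.Mf j t prev u' v) 1)
    (hM : ∀ t ∈ terms, ∀ j prev u' v, ∀ e'' ∈ Set.uIcc (0 : ℝ) 1, (RZ.Mf j t prev u' v e'').PosDef)
    (hC : ∀ t ∈ terms, ∀ j prev u' v, ∀ i i', ContDiffOn ℝ (RZ.nbar + 1 : ℕ) (fun e'' => RZ.Mf j t prev u' v e'' i i') (Set.uIcc 0 1)) :
    IsDT (axialMeasure P k U1) terms Λ qU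
        (bracket596 (fill41 (fillSteps D RG RS ⟨sMid1 (rotTorus P k ι ek η lam0 PB e e') T a Λ s lamφ lamψ c, F, nbar, δR⟩ RZ)
          T w a Λ s lamφ lamψ c χins))
        (rho596 terms Λ (renamedBracket Qφ a (rho528 w T) Λ lamφ lamψ)) ∧
      ∫ v, ∫ ψ, rho596 terms Λ (renamedBracket Qφ a (rho528 w T) Λ lamφ lamψ) v ψ ∂volume ∂fieldMeasure P (k+1) U1 =
        ∫ v, ∫ ψ, ρL v ψ ∂volume ∂fieldMeasure P (k+1) U1 :=
  eq596_bySteps D T a Qφ Λ s lamφ lamψ c RG RS RZ w hk h528 hρi hmφ hmψ hs S hsupp hQS χins hins hLG hread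
    (rotTorus P k ι ek η lam0 PB e e') hQread (hQcov_torus T Λ s lamφ c hk ukU hukT e e' hη lam0 PB)
    (hΔ_torus T Λ s lamφ c hk ukU hukT e e' hη lam0 PB haD hcD hcubeD lamD ζD hΔT) hPread hPinv F nbar δR hLS hreadS ekZ ηZ lamZ hZv
    (hZaway_torus T Λ s hk ukU hukT κZ EZ NZ haZ hcZ hcubeZ lamZw ζZ ΛZ hZT hηZ lamZ) hZread hM hC

/-- **The same for the v1.1 head `BIJ88Eq596BySteps.eq596_bySteps_ins`** (step (5) `hins` discharged from the five printed bounds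
(5.9.1)–(5.9.5) by `BIJ88Eq596Insertions.hins_of_bounds`): (5.9.6) at measure level with the (4.16)-clauses `hQcov`/`hΔ`/`hZaway`
DISCHARGED for the concrete torus slots AND (C) discharged — the displayed hypotheses are the standing data, `Laws`/regularity, the
readings, `hPinv`, the positivity of the radii and the five printed bounds on the support. [cite: BalabanImbrieJaffe1988, (5.9.6) p.297] -/
theorem eq596_bySteps_ins_bgTorus (D : Bracket596 P k ι) (T : ι → Term41 P k) (a : ℝ)
    (Qφ : ι → Prev P k → GaugeField P k U1 → HiggsField P k → HiggsField P (k+1))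
    (Λ : ι → Finset (PBond P (k+1))) (s : ι → GaugeField P (k+1) U1 → GaugeField P k U1)
    (lamφ : ι → Prev P k → GaugeField P k U1 → GaugeField P (k+1) U1 → GaugeTransf P k U1)
    (lamψ : ι → Prev P k → GaugeField P k U1 → GaugeField P (k+1) U1 → GaugeTransf P (k+1) U1)
    (c : ι → Prev P k → GaugeField P k U1 → GaugeField P (k+1) U1 → HiggsField P (k+1) → HiggsField P k)
    (RG : GaugeReading P k ι M) (RS : ScalarReading P k ι M' N' F') (RZ : ZReading P k ι nZ)
    (w : ι → Prev P k → GaugeField P k U1 → HiggsField P k → HiggsField P (k+1) → ℝ)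
    (hk : k + 1 ≤ P.m + P.K) (h528 : IsRD (axialMeasure P k U1) terms qU Qφ a (rho528 w T) ρL)
    (hρi : ∀ t ∈ terms, Integrable
      (fun q : Fields P k => rho528 w T t q.2.1 q.1 q.2.2.1 q.2.2.2 * (gaussWeight a (Qφ t q.2.1 q.1 q.2.2.1) q.2.2.2 : ℂ))
      (fieldsMeasure (axialMeasure P k U1)))
    (hmφ : ∀ t ∈ terms, Measurable fun x : GaugeField P k U1 × Prev P k => lamφ t x.2 (uCut qU (Λ t) x.1) (qU x.1))
    (hmψ : ∀ t ∈ terms, Measurable fun x : GaugeField P k U1 × Prev P k => lamψ t x.2 (uCut qU (Λ t) x.1) (qU x.1))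
    (hs : ∀ t ∈ terms, ∀ w, ∀ b ∈ (axialBonds : Finset (PBond P k)), s t w b = 1)
    (S : ι → Set (GaugeField P k U1))
    (hsupp : ∀ t ∈ terms, ∀ prev u' v φ ψ, renamedBracket Qφ a (rho528 w T) Λ lamφ lamψ t prev u' v φ ψ ≠ 0 → u' ∈ S t)
    (hQS : ∀ t ∈ terms, ∀ u' ∈ S t, ∀ w, qU (bondMul u' (s t w)) = qU u' ∧ qU (bondMul u' fun b => (s t w b)⁻¹) = qU u')
    -- (C): the inserted factor of record and the five printed bounds on the support (as in `eq596_bySteps_ins`)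
    (RI : InsertionReading P k ι)
    (hpos : 0 < RI.c * RI.ek * RI.pek ∧ 0 < RI.c * RI.pek * RI.lamk ^ (-(1 / 4 : ℝ)) ∧ 0 < RI.c * RI.pek * RI.s⁻¹ ∧ 0 < RI.c * RI.pek)
    (hbounds : ∀ t ∈ terms, ∀ prev u' v φ ψ, DeltaAx u' →
      w t prev (uOrig Λ s t u' v) (phiOrig Λ s lamφ c t prev u' v φ ψ) (psiOrig Λ s lamψ t prev u' v ψ) *
        (T t).chi prev (cfg (uOrig Λ s t u' v)) (phiOrig Λ s lamφ c t prev u' v φ ψ) ≠ 0 →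
      (∀ p ∈ starP (RI.Λ0' t), ‖RI.rv v p - 1‖ ≤ 9 / 10 * (RI.c * RI.ek * RI.pek)) ∧
      (RI.s ^ P.d < RI.lam → ∀ y ∈ RI.Λ0' t, ‖ψ y‖ ≤ 9 / 10 * (RI.c * RI.pek * RI.lamk ^ (-(1 / 4 : ℝ)))) ∧
      (¬ RI.s ^ P.d < RI.lam → ∀ y ∈ RI.Λ0' t,
        |‖ψ y‖ - (8 * RI.lam) ^ (-(1 / 2 : ℝ)) * RI.s ^ (((P.d : ℝ) - 2) / 2)| ≤ 9 / 10 * (RI.c * RI.pek * RI.s⁻¹)) ∧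
      (∀ b ∈ starB (RI.Λ0' t), ‖covD 1 (RI.rubar t prev u' v) ψ b‖ ≤ 9 / 10 * (RI.c * RI.pek)) ∧
      (∀ b ∈ starB (RI.Λ7 t), |RI.rA u' b| ≤ 9 / 10 * (RI.c * RI.pek)) ∧
      (∀ x ∈ RI.Λ7 t, ‖φ x‖ ≤ 9 / 10 * (RI.c * RI.pek)))
    -- (G): p02's §5.5 dictionary `Laws` and the reading (5.3.2)
    (hLG : ∀ t ∈ terms, (RG.O t).Laws)
    (hread : ∀ t ∈ terms, ∀ prev u' v, DeltaAx u' → (1 / 2 : ℝ) * gaugeForm (T t) (cfg (uOrig Λ s t u' v)) = gLHS RG t prev u' v)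
    -- THE CONCRETE SLOTS: background as a U(1) configuration, level identifications, rotation data, Δ_{k,loc} and Z^{(j)} slot identities
    (ukU : ι → Prev P k → (PBond P k → ℂ) → GaugeField P 0 U1) (hukT : ∀ t prev u, (T t).uk prev u = cfg (ukU t prev u))
    (e : Balaban1983to89.Site P k ≃ Balaban1983to89.Site P (0 + k)) (e' : Balaban1983to89.Site P (k+1) ≃ Balaban1983to89.Site P (0 + k + 1))
    (ek η : ℝ) (hη : η ≠ 0) (lam0 : ι → Prev P k → GaugeField P k U1 → GaugeField P (k+1) U1 → Balaban1983to89.Site P 0 → ℝ)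
    (PB : ι → Prev P k → (PBond P 0 → ℂ) → HiggsField P k → ℝ)
    {ιD : ι → Type} [∀ t, Fintype (ιD t)] (aD cD : ι → ℝ) (haD : ∀ t, 0 < aD t) (hcD : ∀ t, cD t ≠ 0)
    (cubeD : (t : ι) → ιD t → Finset (Balaban1983to89.Site P 0)) (hcubeD : ∀ t α, IsBlockUnion k (cubeD t α))
    (lamD : (t : ι) → ιD t → Balaban1983to89.Site P 0 → Balaban1983to89.Site P 0 → ℝ)
    (ζD : ι → Balaban1983to89.Site P 0 → Balaban1983to89.Site P 0 → ℝ)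
    (hΔT : ∀ t ukf y₁ y₂, (T t).Δloc ukf y₁ y₂ = deltaLocT (aD t) (cD t) (toU1Field ukf) k (cubeD t) (lamD t) (ζD t) (e y₁) (e y₂))
    {ιZ : ι → Fin k → Type} [∀ t j, Fintype (ιZ t j)] (aZ cZ κZ EZ NZ : ι → Fin k → ℝ) (haZ : ∀ t j, 0 < aZ t j) (hcZ : ∀ t j, cZ t j ≠ 0)
    (cubeZ : (t : ι) → (j : Fin k) → ιZ t j → Finset (Balaban1983to89.Site P 0)) (hcubeZ : ∀ t j α, IsBlockUnion j.val (cubeZ t j α))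
    (lamZw : (t : ι) → (j : Fin k) → ιZ t j → Balaban1983to89.Site P 0 → Balaban1983to89.Site P 0 → ℝ)
    (ζZ : ι → Fin k → Balaban1983to89.Site P 0 → Balaban1983to89.Site P 0 → ℝ)
    (ΛZ : (t : ι) → (j : Fin k) → Finset (Balaban1983to89.Site P (0 + j.val)))
    (hZT : ∀ t j ukf, (T t).Zs j ukf = z49Slot (aZ t j) (cZ t j) j.val (cubeZ t j) (lamZw t j) (ζZ t j) (κZ t j) (ΛZ t j) (EZ t j) (NZ t j) ukf)
    -- (S): the readings of the rotation step and the 𝒫_{k,loc} clause; the Sect. 5.6 family; p02's §5.8 dictionary `Laws`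
    (hQread : ∀ t ∈ terms, ∀ prev u' v φ ψ, DeltaAx u' →
      Qφ t prev (uOrig Λ s t u' v) (phiOrig Λ s lamφ c t prev u' v φ ψ) =
        (rotTorus P k ι ek η lam0 PB e e').QB t prev ((T t).uk prev (cfg (uOrig Λ s t u' v))) (phiOrig Λ s lamφ c t prev u' v φ ψ))
    (hPread : ∀ t ∈ terms, ∀ prev u' v φ ψ, DeltaAx u' →
      (T t).Ploc prev (cfg (uOrig Λ s t u' v)) (phiOrig Λ s lamφ c t prev u' v φ ψ) =
        PB t prev ((T t).uk prev (cfg (uOrig Λ s t u' v))) (phiOrig Λ s lamφ c t prev u' v φ ψ))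
    (hPinv : ∀ t ∈ terms, ∀ prev u' v φ ψ, DeltaAx u' →
      PB t prev (ukRot (rotTorus P k ι ek η lam0 PB e e') T Λ s t prev u' v)
          (phiRot (rotTorus P k ι ek η lam0 PB e e') Λ s lamφ c t prev u' v φ ψ) =
        PB t prev ((T t).uk prev (cfg (uOrig Λ s t u' v))) (phiOrig Λ s lamφ c t prev u' v φ ψ))
    (F : ι → Prev P k → GaugeField P k U1 → GaugeField P (k+1) U1 → HiggsField P k → HiggsField P (k+1) → ℝ → ℝ) (nbar : ℕ)
    (δR : Entry P k ι ℝ) (hLS : ∀ t ∈ terms, ∀ prev u' v, (RS.O t prev u' v).Laws)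
    (hreadS : ∀ t ∈ terms, ∀ prev u' v φ ψ, DeltaAx u' →
      F t prev u' v φ ψ 0 = sMid2 RS t prev u' v φ ψ + D.Pkloc t prev u' v φ ψ)
    -- (Z): the gauge-away function and the reading at the gauged background; p13's regularity
    (ekZ ηZ : ℝ) (hηZ : ηZ ≠ 0) (lamZ : ι → Prev P k → GaugeField P k U1 → GaugeField P (k+1) U1 → Balaban1983to89.Site P 0 → ℝ)
    (hZv : ∀ t ∈ terms, ∀ j, (T t).Zv j = RZ.Zv t j)
    (hZread : ∀ t ∈ terms, ∀ prev u' v, DeltaAx u' → ∀ j,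
      (T t).Zs j (bgGaugeU ekZ ηZ (lamZ t prev u' v) ((T t).uk prev (cfg (uOrig Λ s t u' v)))) = Zloc (RZ.Mf j t prev u' v) 1)
    (hM : ∀ t ∈ terms, ∀ j prev u' v, ∀ e'' ∈ Set.uIcc (0 : ℝ) 1, (RZ.Mf j t prev u' v e'').PosDef)
    (hC : ∀ t ∈ terms, ∀ j prev u' v, ∀ i i', ContDiffOn ℝ (RZ.nbar + 1 : ℕ) (fun e'' => RZ.Mf j t prev u' v e'' i i') (Set.uIcc 0 1)) :
    IsDT (axialMeasure P k U1) terms Λ qU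
        (bracket596 (fill41 (fillSteps D RG RS ⟨sMid1 (rotTorus P k ι ek η lam0 PB e e') T a Λ s lamφ lamψ c, F, nbar, δR⟩ RZ)
          T w a Λ s lamφ lamψ c (chiIns RI)))
        (rho596 terms Λ (renamedBracket Qφ a (rho528 w T) Λ lamφ lamψ)) ∧
      ∫ v, ∫ ψ, rho596 terms Λ (renamedBracket Qφ a (rho528 w T) Λ lamφ lamψ) v ψ ∂volume ∂fieldMeasure P (k+1) U1 =
        ∫ v, ∫ ψ, ρL v ψ ∂volume ∂fieldMeasure P (k+1) U1 :=
  eq596_bySteps_bgTorus D T a Qφ Λ s lamφ lamψ c RG RS RZ w hk h528 hρi hmφ hmψ hs S hsupp hQS (chiIns RI)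
    (hins_of_bounds RI T w Λ s lamφ lamψ c hpos hbounds) hLG hread ukU hukT e e' ek η hη lam0 PB aD cD haD hcD cubeD hcubeD lamD ζD hΔT
    aZ cZ κZ EZ NZ haZ hcZ cubeZ hcubeZ lamZw ζZ ΛZ hZT hQread hPread hPinv F nbar δR hLS hreadS ekZ ηZ hηZ lamZ hZv hZread hM hC

end Assembly

end

end Literature.MathematicalPhysics.QuantumFieldTheory.BalabanImbrieJaffe1984to88.BIJ88Eq596BgTorus
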